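import Mathlib
import HarnessLib

/-!
# Small `Sym_n`-modules have alternating-fixed vectors, I: blocks of 3-cycles

Route MonotoneRestoration, crux `OrbitRestorationQP` (stmt-ValiantsHypothesis-18293), line `depth-three-rung`,
stub A_∞ `stub_sigmaPiSigmaValue`, ΣΛΣ sub-rung.  The conditional ΣΛΣ theorems of
`…DerivativeTowerWaringAlt.lean` / `…DerivativeTowerWaringFamily.lean` rest on ONE representation-theoretic
hypothesis `hKey`: a diagonally `Sym(Fin n)`-stable subspace of polynomials of dimension `≤ n^c + c` is
spanned by vectors fixed by all EVEN permutations fixing pointwise `≤ k` indices.  This series of files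
PROVES it by an elementary argument (no Specht modules): cut `Fin n` into `m = n / 3` blocks of three
points, let `γ_i` be the 3-cycle of block `i`; a finite-dimensional representation decomposes into joint
eigenspaces of the commuting `γ_i`, indexed by characters `ε : Fin m → ZMod 3`; block permutations and
in-block transpositions permute the characters, so a character of support `w` forces `≥ max (C(m,w), 2^w)`
nonzero joint eigenspaces, whence `w ≤ c` when the dimension is `≤ n^c + c`; for a character of MAXIMAL
support `N` the partial eigenspace cut out by the blocks in `N` is stable under `Sym` of the other points
and fixed by a 3-cycle there, hence fixed by the alternating group of the other points.

This file (definition-free): the block system as one existence statement (`exists_blockSystem`: block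
points, their 3-cycles, the in-block flips, block permutations), and the
group-theoretic step — a subspace stable under all permutations fixing a set `S` pointwise and fixed by
one 3-cycle off `S` is fixed by every even permutation fixing `S` pointwise
(`fixed_of_threeCycle_fixed`).  Everything is proved. [folklore]
-/

noncomputable section

open scoped Classical

-- `Summit.ValiantsHypothesis.ValiantsHypothesis.…` is the tree's single-conjunct layout (Sub = Summit).
set_option linter.dupNamespace false

namespace Summit.ValiantsHypothesis.ValiantsHypothesis.Theorems

namespace AltFix

open Equiv Equiv.Perm

variable {n m : ℕ}

/-! ### A block system of 3-cycles -/

/-- **Block systems.**  If `3 m ≤ n` there are: block points `b i j` (`i < m`, `j < 3`, pairwise distinct),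
the 3-cycles `γ i = (b i 0  b i 1)(b i 0  b i 2)` (pairwise commuting, of order `3`, supported on block
`i`, commuting with every permutation fixing block `i` pointwise, inverted under conjugation by the
in-block transposition `(b i 1  b i 2)`, which commutes with the other `γ i'`), and for every
`β : Perm (Fin m)` a block permutation `P β` with `P β * γ i * (P β)⁻¹ = γ (β i)`. [folklore] -/
theorem exists_blockSystem (hm : 3 * m ≤ n) :
    ∃ (b : Fin m → Fin 3 → Fin n) (γ : Fin m → Perm (Fin n)) (P : Perm (Fin m) → Perm (Fin n)),
      (∀ i i' j j', b i j = b i' j' → i = i' ∧ j = j') ∧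
      (∀ i, IsThreeCycle (γ i)) ∧ (∀ i, γ i ^ 3 = 1) ∧ (∀ i i', Commute (γ i) (γ i')) ∧
      (∀ i (x : Fin n), (∀ j, x ≠ b i j) → γ i x = x) ∧
      (∀ i (g : Perm (Fin n)), (∀ j, g (b i j) = b i j) → Commute g (γ i)) ∧
      (∀ i, swap (b i 1) (b i 2) * γ i * (swap (b i 1) (b i 2))⁻¹ = (γ i)⁻¹) ∧
      (∀ i i', i' ≠ i → Commute (swap (b i 1) (b i 2)) (γ i')) ∧
      (∀ β i, P β * γ i * (P β)⁻¹ = γ (β i)) := by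
  -- the block points
  let b : Fin m → Fin 3 → Fin n := fun i j => ⟨3 * i + j, by omega⟩
  have hb : ∀ i i' j j', b i j = b i' j' → i = i' ∧ j = j' := by
    intro i i' j j' h
    have h' := congrArg Fin.val h
    simp only [b] at h'
    refine ⟨Fin.ext ?_, Fin.ext ?_⟩ <;> omega
  have hb1 : ∀ {i i' : Fin m}, i ≠ i' → ∀ j j', b i j ≠ b i' j' := fun h j j' e => h (hb _ _ _ _ e).1
  have hb2 : ∀ (i : Fin m) {j j' : Fin 3}, j ≠ j' → b i j ≠ b i j' := fun i _ _ h e => h (hb _ _ _ _ e).2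
  -- the 3-cycles
  let γ : Fin m → Perm (Fin n) := fun i => swap (b i 0) (b i 1) * swap (b i 0) (b i 2)
  have hγ3 : ∀ i, IsThreeCycle (γ i) := fun i =>
    isThreeCycle_swap_mul_swap_same (hb2 i (by decide)) (hb2 i (by decide)) (hb2 i (by decide))
  have hγfix : ∀ i (x : Fin n), (∀ j, x ≠ b i j) → γ i x = x := by
    intro i x hx
    simp only [γ, Perm.mul_apply]
    rw [swap_apply_of_ne_of_ne (hx 0) (hx 2), swap_apply_of_ne_of_ne (hx 0) (hx 1)]
  have hγmv : ∀ i (x : Fin n), γ i x ≠ x → ∃ j, x = b i j := by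
    intro i x hx
    by_contra h
    exact hx (hγfix i x fun j e => h ⟨j, e⟩)
  -- conjugation by a permutation acting on the block points through `f`
  have hconj : ∀ (i : Fin m) (g : Perm (Fin n)) (f : Fin n → Fin n), (∀ j, g (b i j) = f (b i j)) →
      g * γ i * g⁻¹ = swap (f (b i 0)) (f (b i 1)) * swap (f (b i 0)) (f (b i 2)) := by
    intro i g f hg
    calc g * γ i * g⁻¹
        = (g * swap (b i 0) (b i 1) * g⁻¹) * (g * swap (b i 0) (b i 2) * g⁻¹) := by simp only [γ]; group
      _ = _ := by rw [← swap_apply_apply, ← swap_apply_apply, hg, hg, hg]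
  have hcommfix : ∀ i (g : Perm (Fin n)), (∀ j, g (b i j) = b i j) → Commute g (γ i) := by
    intro i g hg
    have h := hconj i g id hg
    exact mul_inv_eq_iff_eq_mul.mp h
  have hγcomm : ∀ i i', Commute (γ i) (γ i') := by
    intro i i'
    by_cases h : i = i'
    · subst h; exact Commute.refl _
    refine Disjoint.commute fun x => ?_
    by_cases hx : γ i x = x
    · exact Or.inl hx
    · right
      obtain ⟨j, rfl⟩ := hγmv i x hx
      exact hγfix i' _ fun j' e => hb1 h j j' e
  -- the flip
  have hflip : ∀ i, swap (b i 1) (b i 2) * γ i * (swap (b i 1) (b i 2))⁻¹ = (γ i)⁻¹ := by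
    intro i
    rw [hconj i (swap (b i 1) (b i 2)) (swap (b i 1) (b i 2)) fun j => rfl,
      swap_apply_of_ne_of_ne (hb2 i (by decide)) (hb2 i (by decide)), swap_apply_left, swap_apply_right]
    simp only [γ, mul_inv_rev, swap_inv]
  have hflipcomm : ∀ i i', i' ≠ i → Commute (swap (b i 1) (b i 2)) (γ i') := fun i i' h =>
    hcommfix i' _ fun j => swap_apply_of_ne_of_ne (hb1 h j 1) (hb1 h j 2)
  -- block permutations
  let F : Perm (Fin m) → Fin n → Fin n := fun β x =>
    if h : (x : ℕ) < 3 * m then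
      ⟨3 * (β ⟨x / 3, by omega⟩ : ℕ) + x % 3, by have := (β ⟨x / 3, by omega⟩).isLt; omega⟩
    else x
  have hFval : ∀ (β : Perm (Fin m)) (x : Fin n) (i : Fin m), (x : ℕ) / 3 = i →
      ((F β x : Fin n) : ℕ) = 3 * (β i : ℕ) + x % 3 := by
    intro β x i hi
    have hlt : (x : ℕ) < 3 * m := by have := i.isLt; omega
    have e : (⟨(x : ℕ) / 3, by omega⟩ : Fin m) = i := Fin.ext hi
    simp only [F, dif_pos hlt, e]
  have hFnot : ∀ (β : Perm (Fin m)) (x : Fin n), ¬ (x : ℕ) < 3 * m → F β x = x := by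
    intro β x h
    simp only [F, dif_neg h]
  have hFF : ∀ (β : Perm (Fin m)) (x : Fin n), F β.symm (F β x) = x := by
    intro β x
    by_cases h : (x : ℕ) < 3 * m
    · let i : Fin m := ⟨x / 3, by omega⟩
      have h1 := hFval β x i rfl
      have h2 := hFval β.symm (F β x) (β i) (by rw [h1]; omega)
      rw [Equiv.symm_apply_apply] at h2
      ext
      rw [h2, h1]
      show 3 * ((x : ℕ) / 3) + (3 * (β i : ℕ) + (x : ℕ) % 3) % 3 = x
      omega
    · rw [hFnot β x h, hFnot β.symm x h]
  let P : Perm (Fin m) → Perm (Fin n) := fun β =>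
    ⟨F β, F β.symm, fun x => hFF β x, fun x => by simpa using hFF β.symm x⟩
  have hPb : ∀ β i j, P β (b i j) = b (β i) j := by
    intro β i j
    have hj := j.isLt
    ext
    show ((F β (b i j) : Fin n) : ℕ) = _
    rw [hFval β (b i j) i (by simp only [b]; omega)]
    simp only [b]
    omega
  have hPconj : ∀ β i, P β * γ i * (P β)⁻¹ = γ (β i) := by
    intro β i
    rw [hconj i (P β) (P β) fun j => rfl, hPb, hPb, hPb]
  exact ⟨b, γ, P, hb, hγ3, fun i => by rw [← (hγ3 i).orderOf]; exact pow_orderOf_eq_one _, hγcomm, hγfix,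
    hcommfix, hflip, hflipcomm, hPconj⟩

/-! ### From one 3-cycle to the alternating group -/

/-- **A subspace stable under the pointwise stabiliser of `S` and fixed by one 3-cycle off `S` is fixed by
every even permutation fixing `S` pointwise.**  Here the "subspace" is any predicate `Z` on a type with a
`Perm (Fin n)`-action by a monoid homomorphism `ρ` into functions; stability and fixedness are stated
pointwise. [folklore] -/
theorem fixed_of_threeCycle_fixed {V : Type*} [AddCommGroup V] [Module ℂ V]
    (ρ : Perm (Fin n) →* Module.End ℂ V) (Z : Set V) (S : Set (Fin n))
    (hstab : ∀ g : Perm (Fin n), (∀ x ∈ S, g x = x) → ∀ z ∈ Z, ρ g z ∈ Z)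
    (γ : Perm (Fin n)) (hγ : IsThreeCycle γ) (hγS : ∀ x ∈ S, γ x = x) (hγZ : ∀ z ∈ Z, ρ γ z = z)
    (g : Perm (Fin n)) (hgS : ∀ x ∈ S, g x = x) (hsign : Perm.sign g = 1) :
    ∀ z ∈ Z, ρ g z = z := by
  -- work in `Perm` of the subtype `T = Sᶜ`
  let p : Fin n → Prop := fun x => x ∉ S
  have hp : ∀ f : Perm (Fin n), (∀ x ∈ S, f x = x) → ∀ x, p (f x) ↔ p x := by
    intro f hf x
    constructor
    · intro h hx; exact h (by rw [hf x hx]; exact hx)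
    · intro h hfx
      have : f (f x) = f x := hf _ hfx
      exact h (by rwa [f.injective this] at hfx)
  have hp2 : ∀ f : Perm (Fin n), (∀ x ∈ S, f x = x) → ∀ x, f x ≠ x → p x :=
    fun f hf x hx hxS => hx (hf x hxS)
  -- elements of `Perm (Subtype p)` act through `ofSubtype`, which fixes `S` pointwise
  have hof : ∀ τ : Perm (Subtype p), ∀ x ∈ S, ofSubtype τ x = x :=
    fun τ x hx => ofSubtype_apply_of_not_mem τ (show ¬p x from fun h => h hx)
  -- the 3-cycle restricted to the subtype
  let γ' : Perm (Subtype p) := γ.subtypePerm (hp γ hγS)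
  have hγ' : ofSubtype γ' = γ := ofSubtype_subtypePerm (hp γ hγS) (hp2 γ hγS)
  have hγ'3 : IsThreeCycle γ' := by
    rw [← card_support_eq_three_iff]
    have h3 := hγ.card_support
    rw [← hγ', support_ofSubtype, Finset.card_map] at h3
    exact h3
  -- every 3-cycle of the subtype fixes `Z`
  have h3fix : ∀ τ : Perm (Subtype p), IsThreeCycle τ → ∀ z ∈ Z, ρ (ofSubtype τ) z = z := by
    intro τ hτ z hz
    obtain ⟨c, hc⟩ := isConj_iff.mp (isConj_of_cycleType_eq (hγ'3.cycleType.trans hτ.cycleType.symm))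
    have hz' : ρ (ofSubtype c⁻¹) z ∈ Z := hstab _ (hof _) z hz
    rw [← hc]
    simp only [map_mul, Module.End.mul_apply]
    rw [hγ', hγZ _ hz', ← Module.End.mul_apply, ← map_mul, ← map_mul, mul_inv_cancel, map_one, map_one,
      Module.End.one_apply]
  -- hence every even permutation of the subtype
  have hAfix : ∀ τ : Perm (Subtype p), τ ∈ alternatingGroup (Subtype p) → ∀ z ∈ Z, ρ (ofSubtype τ) z = z := by
    intro τ hτ
    rw [← closure_three_cycles_eq_alternating] at hτ
    refine Subgroup.closure_induction (p := fun τ _ => ∀ z ∈ Z, ρ (ofSubtype τ) z = z) ?_ ?_ ?_ ?_ hτ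
    · exact fun τ hτ => h3fix τ hτ
    · intro z _; rw [map_one, map_one, Module.End.one_apply]
    · intro x y _ _ hx hy z hz
      rw [map_mul, map_mul, Module.End.mul_apply, hy z hz, hx z hz]
    · intro x _ hx z hz
      have h1 : ρ (ofSubtype x) (ρ (ofSubtype x⁻¹) z) = z := by
        rw [← Module.End.mul_apply, ← map_mul, ← map_mul, mul_inv_cancel, map_one, map_one,
          Module.End.one_apply]
      have h2 : ρ (ofSubtype x) (ρ (ofSubtype x⁻¹) z) = ρ (ofSubtype x⁻¹) z :=
        hx _ (hstab (ofSubtype x⁻¹) (hof _) z hz)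
      rw [h2] at h1
      exact h1
  -- apply to `g`
  intro z hz
  have hg' : g.subtypePerm (hp g hgS) ∈ alternatingGroup (Subtype p) := by
    rw [mem_alternatingGroup, sign_subtypePerm g (hp g hgS) (hp2 g hgS), hsign]
  have := hAfix _ hg' z hz
  rwa [ofSubtype_subtypePerm (hp g hgS) (hp2 g hgS)] at this

end AltFix

end Summit.ValiantsHypothesis.ValiantsHypothesis.Theorems

end
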